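import Literature.Algebra.Homology.GroupCohomologyRestrictScalars
import Literature.Algebra.Homology.GroupCohomologyResolutionComparison
import Literature.Algebra.Homology.GroupCohomologyModPiFinite
import Mathlib.RingTheory.Noetherian.Basic
import HarnessLib

/-!
# Finiteness over any coefficient ring from a free resolution of finite type over `ℤ`

Topic `Algebra/Homology`; namespace `Literature.Algebra.Homology`.  One definition with body
(`intRepMap`, restriction of scalars on morphisms) and theorems; no named fact, no instance, no
`sorry`.  Continues `GroupCohomologyRestrictScalars` (`intRep A = A|_ℤ`,
`semimap_intRep_bijective : Hⁿ(G, A|_ℤ) ≅ Hⁿ(G, A)`) and `GroupCohomologyResolutionComparison`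
(`Hⁿ(G, -)` of an `FP_∞` group commutes with directed unions).

The finiteness theorems for arithmetic groups are printed over `ℤ`: "a `ℤ[Γ]`-free resolution of
finite type of the `ℤ[Γ]`-module `ℤ`" [BorelSerre1973, §11.1 (c)], "`H^q(Γ, M)` est de type fini
sur `ℤ` si `M` l'est" [Serre1971CohomologieGroupesDiscrets, §1.8 Remarque].  The consumers
(`p`-adic Hecke algebras, [Scholze2015, §V.4]) need the consequences for coefficient modules over
`ℤ_p`, `𝒪_E`, …: for a group `G` whose trivial module `ℤ` has a projective resolution `P` by free
`ℤ[G]`-modules of finite rank (type `FP_∞` over `ℤ`) and ANY commutative ring `k`,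

* `exists_map_eq_of_directed_int` — **`Hⁿ(G, -)` commutes with directed unions of `k`-linear
  representations** (surjectivity half): the statement over `ℤ`
  (`ResolutionComparison.exists_map_eq_of_directed`) for the restrictions of scalars `A_i|_ℤ`,
  transported along the natural bijections `Hⁿ(G, A|_ℤ) ≅ Hⁿ(G, A)` (`exists_map_eq_nsmul_of_intRep`,
  stated with an integer multiple `N • x` for later use with transfer arguments);
* `moduleFinite_groupCohomology_of_int_resolution` — **`Hⁿ(G, A)` is a finitely generated
  `k`-module for `A` finitely generated over a Noetherian `k`**: `Hⁿ(G, A) ≅ Hⁿ(G, A|_ℤ) ≅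
  Hⁿ(Hom_{ℤ[G]}(P_•, A|_ℤ))` with `Hom_{ℤ[G]}(ℤ[G]^m, A|_ℤ) ≅ A^m` (`Rep.freeLiftLEquiv`); the
  scalar `c ∈ k` acts on the model through the `G`-endomorphism `c · 1_A` of `A|_ℤ`, under which
  the cocycles form a `k`-submodule of `A^m`, finitely generated by Noetherianity
  (`moduleFinite_of_cycleModel`, an abstract form of this bookkeeping).

So "`FP_∞` over `ℤ`" feeds the `k`-linear statements without any base change of resolutions
([Brown1982CohomologyGroups, VIII (4.6), VIII.4 Exercise 1] are stated over an arbitrary ring for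
`FP_∞` over that ring; over `ℤ` they imply the versions over every `k` because the standard
cochain complex does not see the scalars, [Brown1982CohomologyGroups, III.1 Example 3]).

## References

* K. S. Brown, *Cohomology of Groups*, GTM 87 (1982), III.1 Example 3, VIII (4.6), VIII.4 Ex. 1
  [Brown1982CohomologyGroups].
* J.-P. Serre, *Cohomologie des groupes discrets* (1971), §1.8 Remarque
  [Serre1971CohomologieGroupesDiscrets].
* A. Borel, J.-P. Serre, *Corners and arithmetic groups* (1973), §11.1 [BorelSerre1973].
-/

noncomputable section

open CategoryTheory groupCohomology

namespace Literature.Algebra.Homology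

variable {k : Type} [CommRing k] {G : Type} [Group G]

/-! ### Restriction of scalars on morphisms -/

/-- **`φ|_ℤ : A|_ℤ ⟶ B|_ℤ`**: a morphism of `k`-linear representations viewed over `ℤ` (same map).
[folklore] -/
def intRepMap {A B : Rep.{0} k G} (φ : A ⟶ B) : intRep A ⟶ intRep B :=
  Rep.ofHom (LinearMap.intertwiningMap_of_isIntertwiningMap (intRep A).ρ (intRep B).ρ
    φ.hom.toLinearMap.toAddMonoidHom.toIntLinearMap fun g v => Rep.hom_comm_apply φ g v)

/-- `φ|_ℤ` is `φ` on elements. [folklore] -/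
@[simp]
theorem intRepMap_hom_apply {A B : Rep.{0} k G} (φ : A ⟶ B) (v : (intRep A).V) :
    (intRepMap φ).hom v = (φ.hom (v : A.V) : B.V) :=
  rfl

/-- `(-)|_ℤ` is functorial. [folklore] -/
theorem intRepMap_comp {A B C : Rep.{0} k G} (φ : A ⟶ B) (ψ : B ⟶ C) :
    intRepMap (φ ≫ ψ) = intRepMap φ ≫ intRepMap ψ :=
  Rep.hom_ext (Representation.IntertwiningMap.ext (LinearMap.ext fun _ => rfl))

/-- `ofIntRep` intertwines `φ|_ℤ` and `φ`. [folklore] -/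
theorem ofIntRep_intRepMap {A B : Rep.{0} k G} (φ : A ⟶ B) (a : (intRep A).V) :
    ofIntRep B ((intRepMap φ).hom a) = φ.hom (ofIntRep A a) :=
  rfl

/-- The scalar `c ∈ k` as a `G`-endomorphism `c · 1` of `A|_ℤ`. [folklore] -/
theorem intRepMap_smul_id_hom_apply (A : Rep.{0} k G) (c : k) (v : (intRep A).V) :
    (intRepMap (c • 𝟙 A)).hom v = (c • (v : A.V) : A.V) :=
  rfl

/-! ### Directed unions over `k` from the statement over `ℤ` -/

/-- **Transport of "directed-union surjectivity up to a multiple" from `A_i|_ℤ` to `A_i`.**  If every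
class `x'` of `Hⁿ(G, B|_ℤ)` has `N • x'` in the image of some `Hⁿ(G, A_i|_ℤ)`, then every class
`x` of `Hⁿ(G, B)` has `N • x` in the image of some `Hⁿ(G, A_i)` (`Hⁿ(G, A|_ℤ) → Hⁿ(G, A)` is a
natural bijection). [cite: Brown1982CohomologyGroups, III.1 Example 3] -/
theorem exists_map_eq_nsmul_of_intRep {ι : Sort*} {A : ι → Rep.{0} k G} {B : Rep.{0} k G}
    (φ : ∀ i, A i ⟶ B) (N : ℕ) (n : ℕ)
    (h : ∀ x' : groupCohomology (intRep B) n, ∃ i, ∃ y' : groupCohomology (intRep (A i)) n,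
      map (MonoidHom.id G) (intRepMap (φ i)) n y' = N • x')
    (x : groupCohomology B n) :
    ∃ i, ∃ y : groupCohomology (A i) n, map (MonoidHom.id G) (φ i) n y = N • x := by
  obtain ⟨x', rfl⟩ := (semimap_intRep_bijective B n).2 x
  obtain ⟨i, y', hy'⟩ := h x'
  refine ⟨i, semimap (ofIntRep (A i)) (ofIntRep_equivariant (A i)) n y', ?_⟩
  rw [← semimap_map (ofIntRep (A i)) (ofIntRep_equivariant (A i)) (ofIntRep B)
    (ofIntRep_equivariant B) (intRepMap (φ i)) (φ i) (fun a => rfl) n y', hy', map_nsmul]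

/-- **`Hⁿ(G, -)` commutes with directed unions of `k`-linear representations when `G` is of type
`FP_∞` over `ℤ`** (surjectivity half): for a projective resolution `P` of `ℤ` by free
`ℤ[G]`-modules of finite rank and a directed family of subrepresentations `φ_i : A_i ↪ B`
(transition maps `t`) exhausting `B`, every class of `Hⁿ(G, B)` comes from some `Hⁿ(G, A_i)`.
[cite: Brown1982CohomologyGroups, VIII (4.6)] [cite: Serre1971CohomologieGroupesDiscrets, §1.8 Remarque] -/
theorem exists_map_eq_of_directed_int {ι : Type*} [Preorder ι] [IsDirected ι (· ≤ ·)] [Nonempty ι]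
    (P : ProjectiveResolution (Rep.trivial ℤ G ℤ))
    (hP : ∀ i, ∃ m : ℕ, Nonempty (P.complex.X i ≅ Rep.free ℤ G (Fin m)))
    {A : ι → Rep.{0} k G} {B : Rep.{0} k G} (φ : ∀ i, A i ⟶ B)
    (hinj : ∀ i, Function.Injective (φ i).hom)
    (t : ∀ ⦃i j⦄, i ≤ j → (A i ⟶ A j)) (ht : ∀ ⦃i j⦄ (h : i ≤ j), t h ≫ φ j = φ i)
    (hcov : ∀ b : B, ∃ i, ∃ a : A i, (φ i).hom a = b) (n : ℕ) (x : groupCohomology B n) :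
    ∃ i, ∃ y : groupCohomology (A i) n, map (MonoidHom.id G) (φ i) n y = x := by
  have h := exists_map_eq_nsmul_of_intRep φ 1 n (fun x' => ?_) x
  · simpa only [one_smul] using h
  obtain ⟨i, y', hy'⟩ := ResolutionComparison.exists_map_eq_of_directed P hP
    (A := fun i => intRep (A i)) (B := intRep B) (fun i => intRepMap (φ i))
    (fun i => by exact hinj i) (fun _ _ h => intRepMap (t h))
    (fun _ _ h => by rw [← intRepMap_comp, ht]) (fun b => by exact hcov b) n x'
  exact ⟨i, y', by rw [hy', one_smul]⟩

/-! ### Finitely generated cohomology over a Noetherian `k` -/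

/-- **Abstract bookkeeping: a module with a "cycle model" inside a finitely generated module is
finitely generated.**  Let `k` be Noetherian, `H` a `k`-module, `N` a finitely generated
`k`-module, `C` an abelian group with a surjective additive `pr : C → H` and an injective additive
`co : C → N`, and an operation `act : k → C → C` which `co` turns into the scalar action of `N` and
`pr` into that of `H`.  Then `H` is finitely generated (the image of `co` is a `k`-submodule of `N`,
hence finitely generated; preimages of its generators generate `H`). [folklore] -/
theorem moduleFinite_of_cycleModel [IsNoetherianRing k] {H : Type*} [AddCommGroup H] [Module k H]
    {N : Type*} [AddCommGroup N] [Module k N] [Module.Finite k N] {C : Type*} [AddCommGroup C]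
    (pr : C →+ H) (hpr : Function.Surjective pr) (co : C →+ N) (hco : Function.Injective co)
    (act : k → C → C) (hact_co : ∀ (c : k) (z : C), co (act c z) = c • co z)
    (hact_pr : ∀ (c : k) (z : C), pr (act c z) = c • pr z) : Module.Finite k H := by
  classical
  -- the `k`-submodule of `N` cut out by `C`
  let Z : Submodule k N :=
    { carrier := Set.range co
      add_mem' := by
        rintro _ _ ⟨z, rfl⟩ ⟨z', rfl⟩
        exact ⟨z + z', map_add co z z'⟩
      zero_mem' := ⟨0, map_zero co⟩
      smul_mem' := by
        rintro c _ ⟨z, rfl⟩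
        exact ⟨act c z, hact_co c z⟩ }
  obtain ⟨T, hT⟩ : Z.FG := IsNoetherian.noetherian Z
  -- preimages of the generators
  have hsec : ∀ t : N, t ∈ T → ∃ z : C, co z = t := fun t ht => by
    have : t ∈ Z := hT ▸ Submodule.subset_span ht
    exact this
  choose zsec hzsec using hsec
  refine ⟨⟨T.attach.image fun t => pr (zsec t.1 t.2), ?_⟩⟩
  rw [eq_top_iff]
  rintro h -
  obtain ⟨z, rfl⟩ := hpr h
  -- expand `co z` on the generators
  have hz : co z ∈ Submodule.span k (T : Set N) := by
    rw [hT]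
    exact ⟨z, rfl⟩
  obtain ⟨f, -, hf⟩ := Submodule.mem_span_finset.1 hz
  -- the corresponding combination of the chosen preimages
  have hz' : z = ∑ t ∈ T.attach, act (f t.1) (zsec t.1 t.2) := hco <| by
    rw [map_sum, ← hf, ← Finset.sum_attach T]
    exact Finset.sum_congr rfl fun t _ => by rw [hact_co, hzsec]
  rw [hz', map_sum]
  refine Submodule.sum_mem _ fun t ht => ?_
  rw [hact_pr]
  exact Submodule.smul_mem _ _ (Submodule.subset_span (Finset.mem_coe.2
    (Finset.mem_image.2 ⟨t, ht, rfl⟩)))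

/-- Naturality of `resolutionIso⁻¹` (element form). [folklore] -/
theorem resolutionIso_inv_apply_homologyMap {k' : Type} [CommRing k'] {G' : Type} [Group G']
    (P : ProjectiveResolution (Rep.trivial k' G' k')) {A B : Rep.{0} k' G'} (f : A ⟶ B) (n : ℕ)
    (w : (P.complex.linearYonedaObj k' A).homology n) :
    (ResolutionComparison.resolutionIso P B n).inv
        (HomologicalComplex.homologyMap (ResolutionComparison.postcomp P.complex f) n w) =
      map (MonoidHom.id G') f n ((ResolutionComparison.resolutionIso P A n).inv w) := by
  obtain ⟨y, rfl⟩ : ∃ y, (ResolutionComparison.resolutionIso P A n).hom y = w :=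
    ⟨(ResolutionComparison.resolutionIso P A n).inv w,
      LinearMap.congr_fun (congrArg ModuleCat.Hom.hom
        (ResolutionComparison.resolutionIso P A n).inv_hom_id) w⟩
  rw [← ResolutionComparison.resolutionIso_hom_apply_map]
  change ((ResolutionComparison.resolutionIso P B n).hom ≫
      (ResolutionComparison.resolutionIso P B n).inv) _ =
    map (MonoidHom.id G') f n (((ResolutionComparison.resolutionIso P A n).hom ≫
      (ResolutionComparison.resolutionIso P A n).inv) y)
  rw [Iso.hom_inv_id, Iso.hom_inv_id]
  rfl

/-- **`Hⁿ(G, A)` is finitely generated over `k` for `G` of type `FP_∞` over `ℤ`.**  If the trivial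
`ℤ[G]`-module `ℤ` has a projective resolution `P` with every term isomorphic to a free
`ℤ[G]`-module of finite rank, then for every representation `A` of `G` finitely generated over a
Noetherian commutative ring `k` and every `n`, `Hⁿ(G, A)` is a finitely generated `k`-module
("`H^q(Γ, M)` est de type fini sur `ℤ` si `M` l'est", and the same over any Noetherian coefficient
ring since the standard complex does not see the scalars).
[cite: Serre1971CohomologieGroupesDiscrets, §1.8 Remarque]
[cite: Brown1982CohomologyGroups, VIII.4 Exercise 1; III.1 Example 3] -/
theorem moduleFinite_groupCohomology_of_int_resolution [IsNoetherianRing k]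
    (P : ProjectiveResolution (Rep.trivial ℤ G ℤ))
    (hP : ∀ i, ∃ m : ℕ, Nonempty (P.complex.X i ≅ Rep.free ℤ G (Fin m)))
    (A : Rep.{0} k G) [Module.Finite k A] (n : ℕ) : Module.Finite k (groupCohomology A n) := by
  classical
  obtain ⟨m, ⟨e⟩⟩ := hP n
  -- the model complex `Hom(P_•, A|_ℤ)` and coordinates `(P_n ⟶ A|_ℤ) ≃ A^m` of its `n`-cochains
  let coord : (P.complex.X n ⟶ intRep A) ≃ₗ[ℤ] (Fin m → A.V) :=
    (Linear.homCongr ℤ e (Iso.refl (intRep A))).trans (Rep.freeLiftLEquiv ℤ G (Fin m) (intRep A))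
  have hcoord_apply : ∀ (g : P.complex.X n ⟶ intRep A) (i : Fin m),
      coord g i = ((e.inv ≫ g).hom
        (Finsupp.single i (.single 1 1) : Fin m →₀ MonoidAlgebra ℤ G) : A.V) := fun g i => by
    change (Rep.freeLiftLEquiv ℤ G (Fin m) (intRep A) ((e.inv ≫ g) ≫ 𝟙 (intRep A))) i = _
    rw [Category.comp_id]
    rfl
  -- the scalar `c` acts on the model through the endomorphism `c · 1` of `A|_ℤ`
  let μ : k → (intRep A ⟶ intRep A) := fun c => intRepMap (c • 𝟙 A)
  have hcoord : ∀ (c : k) (g : P.complex.X n ⟶ intRep A), coord (g ≫ μ c) = c • coord g :=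
    fun c g => funext fun i => by
      rw [Pi.smul_apply, hcoord_apply, hcoord_apply, ← Category.assoc, Rep.comp_apply]
      rfl
  -- the cycle model
  refine moduleFinite_of_cycleModel (N := Fin m → A.V) (C := (P.complex.linearYonedaObj ℤ (intRep A)).cycles n)
    (((semimap (ofIntRep A) (ofIntRep_equivariant A) n).toAddMonoidHom.comp
      (ResolutionComparison.resolutionIso P (intRep A) n).inv.hom.toAddMonoidHom).comp
      ((P.complex.linearYonedaObj ℤ (intRep A)).homologyπ n).hom.toAddMonoidHom) ?_
    (coord.toAddMonoidHom.comp ((P.complex.linearYonedaObj ℤ (intRep A)).iCycles n).hom.toAddMonoidHom) ?_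
    (fun c z => HomologicalComplex.cyclesMap (ResolutionComparison.postcomp P.complex (μ c)) n z)
    (fun c z => ?_) (fun c z => ?_)
  · -- surjective
    refine (semimap_intRep_bijective A n).2.comp (Function.Surjective.comp ?_
      (ResolutionComparison.homologyπ_surjective (P.complex.linearYonedaObj ℤ (intRep A)) n))
    exact (ResolutionComparison.resolutionIso P (intRep A) n).toLinearEquiv.symm.surjective
  · -- injective
    exact coord.injective.comp (ResolutionComparison.iCycles_injective (P.complex.linearYonedaObj ℤ (intRep A)) n)
  · -- `co (act c z) = c • co z` (stated through `Eq.trans`: the two instance paths to `Ring ℤ`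
    -- make the generic lemmas match only up to unfolding of instances)
    have h1 := ResolutionComparison.iCycles_cyclesMap (ResolutionComparison.postcomp P.complex (μ c)) n z
    have h2 := ResolutionComparison.postcomp_f_apply P.complex (μ c) n
      ((P.complex.linearYonedaObj ℤ (intRep A)).iCycles n z)
    exact (congrArg coord (h1.trans h2)).trans (hcoord c _)
  · -- `pr (act c z) = c • pr z`
    have h1 := (ResolutionComparison.homologyMap_homologyπ
      (ResolutionComparison.postcomp P.complex (μ c)) n z).symm
    have h2 := resolutionIso_inv_apply_homologyMap P (μ c) n
      ((P.complex.linearYonedaObj ℤ (intRep A)).homologyπ n z)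
    have h3 := semimap_map (ofIntRep A) (ofIntRep_equivariant A) (ofIntRep A) (ofIntRep_equivariant A)
      (μ c) (c • 𝟙 A) (fun a => rfl) n ((ResolutionComparison.resolutionIso P (intRep A) n).inv
        ((P.complex.linearYonedaObj ℤ (intRep A)).homologyπ n z))
    have h4 := map_smul_id_apply A c n (semimap (ofIntRep A) (ofIntRep_equivariant A) n
      ((ResolutionComparison.resolutionIso P (intRep A) n).inv
        ((P.complex.linearYonedaObj ℤ (intRep A)).homologyπ n z)))
    exact (congrArg (fun v => semimap (ofIntRep A) (ofIntRep_equivariant A) n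
      ((ResolutionComparison.resolutionIso P (intRep A) n).inv v)) h1).trans
      ((congrArg (semimap (ofIntRep A) (ofIntRep_equivariant A) n) h2).trans (h3.trans h4))

end Literature.Algebra.Homology
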